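import Summits.QuantumAdvantage.AdviceFreeQNC0.WalkFailSetHits
import Summits.QuantumAdvantage.AdviceFreeQNC0.WalkAdaptedFarPattern
import HarnessLib

/-!
# Cell qa-qnc0 (rung F-Q1, route RingFrame, crux α `RingToElim`): FAIL-SET HITS with the SHARP
# block length `m ≥ 2D + 3D' + 3` — the fail set of a degree-`D` strategy is an interpolating set
# for degree `D'`; density-axis exponent `≈ 1.39`, below `log₂ 3`

`WalkFailSetHits.lean` proved planner qa-qnc0-p1's `FailSetHits` (TARGET §15.4(b)) for
`m ≥ 2D + 4D' + 3` by a Möbius step over the subcube `{σ_T alt : T ⊆ S₀}` around the GLOBAL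
alternating pattern; the `4D'` pays once for the degree of `Q` and once more because flipping
`alt` inside `S₀` can move it `|S₀| ≤ D'` closer to the path.  Alternating ALONG THE COMPLEMENT
`R = [m] ∖ S₀` instead (the pattern `altAlong R`, letter `2` at the odd-ranked elements of `R`)
costs only the `|S₀|` deleted letters: its restriction to `R` is at distance `≥ ⌊(|R|−1)/2⌋` from
every path pattern and conjugate, whatever happens inside `S₀`.  Hence:

(`WalkAdaptedFarPattern.lean`: `altAlong R`, `far_flipOn_altAlong` — for `|S₀| ≤ D'`, `T ⊆ S₀` and
`m ≥ 2D + 3D' + 3` the pattern `σ_T (altAlong R)` and its conjugate are at distance `> D' + D`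
from the path).  Over it:

* **`eq_zero_of_vanish_on_failSet_sharp`** — THE INTERPOLATION THEOREM at `m ≥ 2D + 3D' + 3`
  (same Möbius step, `sum_powerset_prod_twist_eq_zero/_self`); `numMonomials_le_card_failSet_sharp`;
* `le_card_fail_of_fibres` — the fibre gluing once and for all (any per-block fail bound `N` for
  full strategies of degree `D` on `m` bits gives `2^q·N` on `m + q` bits);
  **`ringWinU_failSetHits_sharp`** (`#FAIL ≥ 2^{ℓ−m}·N_{D'}(m)`, `2D+3D'+3 ≤ m ≤ ℓ`, every charge),
  `card_ringWinU_le_failSetHits_sharp`, **`mixedHardAt_failSetHits_sharp`**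
  (`MixedHardAt ℓ D (1 − N_{D'}(m)/2^m)`, `2D + 3D' + 5 ≤ m ≤ ℓ`).

Numbers (deficit bits `−log₂(#FAIL/2ⁿ)`; planner ROUND-11 §1.1): with the best `D'` —
`15.5` at `D = 8` (`D' = 7`, `m = 40`), `32.8` at `D = 20` (`D' = 18`, `m = 97`), `61.0` at `D = 40`
(`D' = 36`), `117.0` at `D = 80` (`D' = 72`), `284.3` at `D = 200` (`D' = 179`); asymptotically
`min_x (1 − H((1−2x)/3))/x ≈ 1.388·D` (at `m ≈ 4.7D`, `D' ≈ 0.87D`) — below the degree-0 tensor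
floor `log₂3·D ≈ 1.585·D` (`WalkTensorZeroFloor.lean`; `35.1` at `D = 20`), the `4D'` version
(`1.757·D`) and the fail floor (`2D+3`).  Sharpness: at `D = 0` the threshold `3D' + 3` is exact
(`m = 3D'+2` has non-interpolating constant strategies for `D' = 1, 2`: exhaustive check, prover
qn-prover-3 gen 6).  The cell's theorem (prover qn-prover-3 gen 6), 2026-08-27; not in print.
WHAT THIS IS NOT: exponent `≈ 1.39`, not `< 1` (T10 / `T10W` untouched); nothing on α at constant
`η`; no separation claim.
-/

noncomputable section

namespace Summit.QuantumAdvantage.AdviceFreeQNC0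

open Finset
open Literature.Computability.MetaComplexity Literature.Computability.MetaComplexity.Smolensky
open F4

variable {m : ℕ}

/-! ### The interpolation theorem at the sharp length -/

/-- The two elements of `𝔽₂`. -/
private theorem zmod2_eq_zero_or_one'' (s : ZMod 2) : s = 0 ∨ s = 1 := by
  fin_cases s
  · exact Or.inl rfl
  · exact Or.inr rfl

/-- **FAIL SETS ARE INTERPOLATING SETS, sharp length**: for `f` in the full module `M_D(P)` on
`m ≥ 2D + 3D' + 3` bits, an `𝔽₂`-polynomial of degree `≤ D'` that vanishes wherever `f` fails
(`tr f ≠ 1`) vanishes identically. [folklore] -/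
theorem eq_zero_of_vanish_on_failSet_sharp {D D' : ℕ} (hm : 2 * D + 3 * D' + 3 ≤ m)
    {f : (Fin m → Bool) → F4} (hf : f ∈ fullSpan m D) {Q : CubeFn (ZMod 2) m}
    (hQ : Q ∈ lowDeg (ZMod 2) m D') (hvan : ∀ u, tr (f u) ≠ 1 → Q u = 0) : Q = 0 := by
  classical
  haveI := F4.nontrivial
  have hQ' := hQ
  rw [lowDeg_eq_span] at hQ'
  obtain ⟨c, hc⟩ := Finsupp.mem_span_range_iff_exists_finsupp.1 hQ'
  by_contra hne
  have hc0 : c.support.Nonempty := by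
    rw [Finset.nonempty_iff_ne_empty, ne_eq, Finsupp.support_eq_empty]
    rintro rfl
    apply hne
    rw [← hc]
    simp
  obtain ⟨σ₀, hσ₀, hmax⟩ := Finset.exists_max_image c.support (fun σ => σ.1.card) hc0
  set S₀ : Finset (Fin m) := σ₀.1 with hS₀
  have hS₀D : S₀.card ≤ D' := σ₀.2
  -- the adapted far pattern
  set b : Fin m → Bool := altAlong (univ \ S₀) with hb
  have hLQ : ∀ a : Fin m → Bool, ω ^ (2 * lettSum univ a) * Lfun a (fun u => algebraMap (ZMod 2) F4 (Q u)) =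
      ∑ σ ∈ c.support, algebraMap (ZMod 2) F4 (c σ) * ∏ i ∈ σ.1, twist a i := by
    intro a
    have eQ : (fun u => algebraMap (ZMod 2) F4 (Q u)) =
        fun u => ∑ σ ∈ c.support, (fun σ u => algebraMap (ZMod 2) F4 (c σ) * monoF σ.1 u) σ u := by
      funext u
      rw [← hc]
      simp only [Finsupp.sum, Finset.sum_apply, Pi.smul_apply, smul_eq_mul, map_sum, map_mul]
      refine Finset.sum_congr rfl fun σ _ => ?_
      congr 1
      unfold mono monoF ιF
      rw [map_prod]
      refine Finset.prod_congr rfl fun i _ => ?_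
      by_cases h : u i = true <;> simp [h]
    rw [eQ, Lfun_sum_apply, Finset.mul_sum]
    refine Finset.sum_congr rfl fun σ _ => ?_
    rw [Lfun_mul_apply a _ (monoF σ.1), mul_left_comm, twist_mul_Lfun_monoF]
  have hzero : ∀ T ∈ S₀.powerset,
      ∑ σ ∈ c.support, algebraMap (ZMod 2) F4 (c σ) * ∏ i ∈ σ.1, twist (flipOn T b) i = 0 := by
    intro T hT
    obtain ⟨hfar, hfar'⟩ := far_flipOn_altAlong (D := D) hm hS₀D (Finset.mem_powerset.1 hT)
    rw [← hLQ, hb, Lfun_algebraMap_eq_zero_of_vanish hf hQ hvan hfar hfar', mul_zero]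
  have hsum : ∑ T ∈ S₀.powerset, ∑ σ ∈ c.support,
      algebraMap (ZMod 2) F4 (c σ) * ∏ i ∈ σ.1, twist (flipOn T b) i = 1 := by
    rw [Finset.sum_comm]
    have inner : ∀ σ ∈ c.support, ∑ T ∈ S₀.powerset,
        algebraMap (ZMod 2) F4 (c σ) * ∏ i ∈ σ.1, twist (flipOn T b) i =
          if σ = σ₀ then 1 else 0 := by
      intro σ hσ
      rw [← Finset.mul_sum]
      by_cases hσσ : σ = σ₀
      · rw [if_pos hσσ, hσσ, sum_powerset_prod_twist_self, mul_one]
        have hcσ : c σ₀ ≠ 0 := Finsupp.mem_support_iff.1 hσ₀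
        rcases zmod2_eq_zero_or_one'' (c σ₀) with h0 | h1
        · exact absurd h0 hcσ
        · rw [h1, map_one]
      · rw [if_neg hσσ]
        have hnot : ¬ S₀ ⊆ σ.1 := by
          intro hsub
          have hle := hmax σ hσ
          have heq : S₀ = σ.1 := Finset.eq_of_subset_of_card_le hsub hle
          exact hσσ (Subtype.ext heq.symm)
        obtain ⟨j, hj, hjσ⟩ := Finset.not_subset.1 hnot
        rw [sum_powerset_prod_twist_eq_zero hj hjσ, mul_zero]
    rw [Finset.sum_congr rfl inner, Finset.sum_ite_eq' c.support σ₀ fun _ => (1 : F4), if_pos hσ₀]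
  rw [Finset.sum_eq_zero hzero] at hsum
  exact zero_ne_one hsum

/-- **The fail set of a full strategy has at least `Σ_{j ≤ D'} C(m, j)` points**, `m ≥ 2D + 3D' + 3`.
[folklore] -/
theorem numMonomials_le_card_failSet_sharp {D D' : ℕ} (hm : 2 * D + 3 * D' + 3 ≤ m)
    {f : (Fin m → Bool) → F4} (hf : f ∈ fullSpan m D) :
    numMonomials m D' ≤ (univ.filter fun u : Fin m → Bool => tr (f u) ≠ 1).card := by
  classical
  by_contra hlt
  rw [not_le] at hlt
  have h := card_closure_lt_of_card_lt (F := ZMod 2) hlt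
  have hne : (closure (ZMod 2) D' (univ.filter fun u : Fin m → Bool => tr (f u) ≠ 1)) ≠ univ := by
    intro h'
    rw [h', Finset.card_univ, Fintype.card_fun, Fintype.card_bool, Fintype.card_fin] at h
    exact lt_irrefl _ h
  obtain ⟨a, -, ha⟩ : ∃ a ∈ (univ : Finset (Fin m → Bool)),
      a ∉ closure (ZMod 2) D' (univ.filter fun u : Fin m → Bool => tr (f u) ≠ 1) := by
    by_contra h'
    push Not at h'
    exact hne (Finset.eq_univ_of_forall fun a => h' a (Finset.mem_univ a))
  rw [mem_closure] at ha
  push Not at ha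
  obtain ⟨Q, hQ, hvan, hQa⟩ := ha
  have hvan' : ∀ u, tr (f u) ≠ 1 → Q u = 0 :=
    fun u hu => hvan u (Finset.mem_filter.2 ⟨Finset.mem_univ u, hu⟩)
  exact hQa (by rw [eq_zero_of_vanish_on_failSet_sharp hm hf hQ hvan']; rfl)

/-! ### Fail counts: the walk game and the mixed game -/

/-- **Fibre gluing**: a fail bound `N` for full strategies of degree `D` on `m` bits gives
`2^q · N` for every walk strategy of `𝔽₂`-degree `≤ D` on `m + q` bits, every charge. -/
theorem le_card_fail_of_fibres {D : ℕ} {m : ℕ} (N : ℕ)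
    (hN : ∀ f : (Fin m → Bool) → F4, f ∈ fullSpan m D →
      N ≤ (univ.filter fun w : Fin m → Bool => tr (f w) ≠ 1).card)
    (q c : ℕ) (y : Fin (m + q + 1) → (Fin (m + q) → Bool) → Bool) (hy : ∀ g, HasDeg (y g) D) :
    2 ^ q * N ≤ (univ.filter fun u : Fin (m + q) → Bool => ringWinU c y u = false).card := by
  classical
  have hEb : ∀ b : Fin q → Bool,
      N ≤ (univ.filter fun w : Fin m → Bool => ringWinU c y (Fin.append w b) = false).card := by
    intro b
    refine le_trans (hN _ (fibre_mem_fullSpan c y hy b)) (Finset.card_le_card fun w hw => ?_)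
    rw [Finset.mem_filter] at hw ⊢
    refine ⟨Finset.mem_univ _, ?_⟩
    have hw' := hw.2
    rw [tr_fibreFun] at hw'
    cases hwin : ringWinU c y (Fin.append w b)
    · rfl
    · rw [hwin] at hw'
      exact absurd rfl hw'
  have hinj : Set.InjOn (fun p : (Σ _ : Fin q → Bool, Fin m → Bool) => Fin.append p.2 p.1)
      (univ.sigma (fun b : Fin q → Bool =>
        univ.filter fun w : Fin m → Bool => ringWinU c y (Fin.append w b) = false) :
          Set (Σ _ : Fin q → Bool, Fin m → Bool)) := by
    rintro ⟨b, w⟩ _ ⟨b', w'⟩ _ h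
    have hb : b = b' := by
      funext j
      have := congrFun h (Fin.natAdd m j)
      simpa only [Fin.append_right] using this
    have hw : w = w' := by
      funext i
      have := congrFun h (Fin.castAdd q i)
      simpa only [Fin.append_left] using this
    subst hb; subst hw; rfl
  have hmaps : ∀ p ∈ univ.sigma (fun b : Fin q → Bool =>
        univ.filter fun w : Fin m → Bool => ringWinU c y (Fin.append w b) = false),
      (fun p : (Σ _ : Fin q → Bool, Fin m → Bool) => Fin.append p.2 p.1) p ∈
        (univ.filter fun u : Fin (m + q) → Bool => ringWinU c y u = false) := by
    rintro ⟨b, w⟩ hp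
    rw [Finset.mem_sigma] at hp
    exact Finset.mem_filter.2 ⟨Finset.mem_univ _, (Finset.mem_filter.1 hp.2).2⟩
  have h := Finset.card_le_card_of_injOn _ hmaps hinj
  rw [Finset.card_sigma] at h
  calc 2 ^ q * N = ∑ _b : Fin q → Bool, N := by
        rw [Finset.sum_const, Finset.card_univ, Fintype.card_fun, Fintype.card_bool, Fintype.card_fin,
          smul_eq_mul]
    _ ≤ ∑ b : Fin q → Bool,
          (univ.filter fun w : Fin m → Bool => ringWinU c y (Fin.append w b) = false).card :=
        Finset.sum_le_sum fun b _ => hEb b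
    _ ≤ _ := h

/-- **FAIL-SET HITS at the sharp length**: every walk strategy of `𝔽₂`-degree `≤ D` on
`ℓ ≥ m ≥ 2D + 3D' + 3` bits fails on at least `2^{ℓ−m} · Σ_{j ≤ D'} C(m, j)` inputs, for every
charge. [folklore] -/
theorem ringWinU_failSetHits_sharp (D D' : ℕ) {m ℓ : ℕ} (hm : 2 * D + 3 * D' + 3 ≤ m) (hℓ : m ≤ ℓ)
    (c : ℕ) (y : Fin (ℓ + 1) → (Fin ℓ → Bool) → Bool) (hy : ∀ g, HasDeg (y g) D) :
    2 ^ (ℓ - m) * numMonomials m D' ≤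
      (univ.filter fun u : Fin ℓ → Bool => ringWinU c y u = false).card := by
  obtain ⟨q, rfl⟩ : ∃ q, ℓ = m + q := ⟨ℓ - m, by omega⟩
  rw [show m + q - m = q by omega]
  exact le_card_fail_of_fibres (numMonomials m D')
    (fun f hf => numMonomials_le_card_failSet_sharp (D := D) hm hf) q c y hy

/-- **The win count under the sharp fail-set-hits floor**: `#WIN ≤ (1 − N_{D'}(m)/2^m)·2^ℓ`,
`2D + 3D' + 3 ≤ m ≤ ℓ`. [folklore] -/
theorem card_ringWinU_le_failSetHits_sharp (D D' : ℕ) {m ℓ : ℕ} (hm : 2 * D + 3 * D' + 3 ≤ m)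
    (hℓ : m ≤ ℓ) (c : ℕ) (y : Fin (ℓ + 1) → (Fin ℓ → Bool) → Bool) (hy : ∀ g, HasDeg (y g) D) :
    ((univ.filter fun u : Fin ℓ → Bool => ringWinU c y u = true).card : ℝ) ≤
      (1 - (numMonomials m D' : ℝ) / (2 : ℝ) ^ m) * (2 : ℝ) ^ ℓ := by
  have hfl := ringWinU_failSetHits_sharp D D' hm hℓ c y hy
  have htot : (univ.filter fun u : Fin ℓ → Bool => ringWinU c y u = false).card +
      (univ.filter fun u : Fin ℓ → Bool => ringWinU c y u = true).card = 2 ^ ℓ := by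
    have h := Finset.card_filter_add_card_filter_not
      (s := (univ : Finset (Fin ℓ → Bool))) (fun u => ringWinU c y u = false)
    have hneg : (univ.filter fun u : Fin ℓ → Bool => ¬ ringWinU c y u = false) =
        univ.filter fun u : Fin ℓ → Bool => ringWinU c y u = true :=
      Finset.filter_congr fun u _ => by simp
    rw [hneg, Finset.card_univ, Fintype.card_fun, Fintype.card_bool, Fintype.card_fin] at h
    exact h
  have hflR : (2 : ℝ) ^ (ℓ - m) * (numMonomials m D' : ℝ) ≤
      ((univ.filter fun u : Fin ℓ → Bool => ringWinU c y u = false).card : ℝ) := by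
    exact_mod_cast hfl
  have htotR : ((univ.filter fun u : Fin ℓ → Bool => ringWinU c y u = false).card : ℝ) +
      ((univ.filter fun u : Fin ℓ → Bool => ringWinU c y u = true).card : ℝ) = (2 : ℝ) ^ ℓ := by
    exact_mod_cast htot
  have hpow : (numMonomials m D' : ℝ) / (2 : ℝ) ^ m * (2 : ℝ) ^ ℓ =
      (2 : ℝ) ^ (ℓ - m) * (numMonomials m D' : ℝ) := by
    have h2 : (2 : ℝ) ^ ℓ = (2 : ℝ) ^ (ℓ - m) * (2 : ℝ) ^ m := by
      rw [← pow_add, Nat.sub_add_cancel hℓ]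
    rw [h2]
    field_simp
  rw [sub_mul, one_mul, hpow]
  linarith

/-- **The sharp fail-set-hits floor of the mixed game**: `MixedHardAt ℓ D (1 − N_{D'}(m)/2^m)` for
`2D + 3D' + 5 ≤ m ≤ ℓ`. [folklore] -/
theorem mixedHardAt_failSetHits_sharp (D D' : ℕ) {m ℓ : ℕ} (hm : 2 * D + 3 * D' + 5 ≤ m)
    (hℓ : m ≤ ℓ) : MixedHardAt ℓ D (1 - (numMonomials m D' : ℝ) / (2 : ℝ) ^ m) := by
  intro c P y hPdeg hPeven hy
  have hℓ1 : 1 ≤ ℓ := by omega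
  obtain ⟨yP, hyP, hwin⟩ := evenTriple_isWalkRow ℓ hℓ1 c D P ⟨hPdeg, hPeven⟩
  have e : (univ.filter fun w : Fin ℓ → Bool => mixedWinU c P y w = true) =
      univ.filter fun w : Fin ℓ → Bool => ringWinU c (fun g w => xor (yP g w) (y g w)) w = true := by
    refine Finset.filter_congr fun w _ => ?_
    unfold mixedWinU
    have hw : P (wt w % 3) w = ringWinU c yP w := hwin w
    rw [hw, ringWinU_xor]
  rw [e]
  have hdeg : ∀ g, HasDeg ((fun g w => xor (yP g w) (y g w)) g) (D + 1) := fun g =>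
    hasDeg_xor (hyP g) (hasDeg_of_le (hy g) (Nat.le_succ _))
  exact card_ringWinU_le_failSetHits_sharp (D + 1) D' (m := m) (by omega) hℓ c _ hdeg

end Summit.QuantumAdvantage.AdviceFreeQNC0

end
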